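/-
Copyright: statement-level skeleton of a published paper (lit-balaban cell, Phase-2 proof seat p39 gen 5). No proof claims
beyond what the kernel checks below.
-/
import Literature.MathematicalPhysics.QuantumFieldTheory.Balaban1983to89.B3Bound323
import Literature.MathematicalPhysics.QuantumFieldTheory.Balaban1983to89.B3CxiTadpole
import Mathlib.Analysis.PSeries

/-!
# B3 — T. Bałaban, *(Higgs)₂,₃ quantum fields in a finite volume. III. Renormalization*, CMP **88** (1983) 411–445
[Balaban1983Higgs3], p. 439 [PDF 29]: the FIRST term of the split bracket of (3.23), `q²g(x)g′(x)Σ_{x′}ξ^d(∂^ξ_μC^ξ)(x − x′)C^ξ(x − x′)`,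
and **(3.24)** — ON THE TORUS, for the torus free propagator `C^ξ_T`: the position-space form of (3.24) (summation by parts) PROVED,
the sum BOUNDED uniformly in the spacing and the volume, and hence *"the last graph in (3.22) defines a vertex with some convergent
function"* for the `C^ξ_T·C^ξ_T` member — the whole (3.23) vertex coefficient bounded by one constant

statement-level skeleton of published theorems with citation tags; proofs where landed; nothing here is a claim about
the Yang–Mills mass gap

PDF held: `paper:balaban1983-higgs-2-3-quantum-fields-finite-volume` (journal page = PDF page + 410); p. 439 [PDF 29] read in the
OCR text (`p0029.txt`).  Row **B3.Eq3.21-3.24** of `HOME/lit-balaban-r15/ROWS-B3.md` (fold owner r15).  (3.24) is typed by r15 on the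
INFINITE lattice `ξℤ^d` (`B3Sect3VectorSelfEnergy.Eq324`: lattice sum = momentum integral, PROVED by p03 `B3Eq324Parseval.eq324_holds`,
with the p. 439 limit sentence `eq324_rhs_finite_limit`); the (3.23) bracket and its p. 439 splitting are r15's
`B3Sect3ScalarSelfEnergy.bracket323` / `bracket323_split`; the second term of the splitting is bounded in `B3Bound323` (this seat).
THIS FILE treats the first term on the TORUS `T^{(j)}_ξ` (r15's `Site P j`, spacing symbol `ξ`), where the resummed propagators of
(3.23) actually live, for the torus free propagator `C^ξ_T` of p03 (`B3CxiTorusBound.CxiT`).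

THE PRINTED TEXT (verbatim, p. 439).  *"… and the expression with the first term is equal to q²g(x)g′(x)Σ_{x′}η^d(∂^η_μG^η_{j″}(0))(x,x′)
G^η_{j″}(x,x′). Rescaling from the η-lattice to the L^{−j″}-lattice and using the same method as in (3.16) we get some convergent
expressions plus q²g(x)g′(x)Σ_{x′}ξ^d(∂^ξ_μC^ξ)(x − x′)C^ξ(x − x′). We have further
Σ_{x′}ξ^d(∂^ξ_μC^ξ)(x − x′)C^ξ(x − x′) = (2π)^{−d}∫dp ξ^{−1}(cos(ξp_μ) − 1)/(Δ^ξ(p) + 1)² = … (3.24)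
and the expression on the right side has a finite limit as ξ → 0. Hence the last graph in (3.22) defines a vertex with some
convergent function."*

WHAT IS PROVED, and how.
* §1 **`sum_d1Kernel_mul_self`** — (3.24) IN POSITION SPACE, for every kernel `K` on the torus invariant under the simultaneous
  translation `(y, y′) ↦ (y + e_μ, y′ + e_μ)` (every translation-invariant kernel `K(y − y′)`, in particular `C^ξ_T`:
  `CxiT_shift_shift`): `Σ_{y′}ξ^d(∂^ξ_μK)(y,y′)K(y,y′) = −(ξ^{d+1}/2)·Σ_{y′}((∂^ξ_μK)(y,y′))²` (`(∂^ξ_μK)(y,y′)` = r15's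
  `d1Kernel ξ⁻¹ μ K`).  This is the x-space content of the printed symmetrisation `ξ^{−1}(e^{iξp_μ} − 1) ↦ ξ^{−1}(cos(ξp_μ) − 1) =
  −(ξ/2)|ξ^{−1}(e^{iξp_μ} − 1)|²` inside (3.24) (Parseval): with `a(y′) = K(y + e_μ, y′)`, `b(y′) = K(y, y′)` one has `Σa² = Σb²`
  (reindex `y′ ↦ y′ − e_μ`), whence `Σ(a − b)b = −½Σ(a − b)²`.  `first324_CxiT_eq`: the instance `K = C^ξ_T`.
* §2 lattice sums: `Σ_{y′ ≠ y}|y − y′|_∞^{−(d+1)} ≤ 4d·3^{d−1}` on every torus (`sum_ne_inv_pow_succ_le`; shells `#{|y−y′|_∞ = s} ≤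
  2d(2s+1)^{d−1}` of p20's `B3TorusRadialSums.card_shell_le` and `Σ_{s≥1}s^{−2} ≤ 2`).
* §3 the DIAGONAL of the torus propagator (d = 3, `0 < ξ ≤ 1`, side `ξN ≥ 1`): `C^ξ_T(y,y) ≤ 472501·ξ^{−1}` (`CxiT_diag_le`: the
  `n = 0` coset term is r15's tadpole bound `B3CxiTadpole.Cxi_zero_le_three`, `C^ξ(0) ≤ (3(π+1)/4π)ξ^{−1} ≤ ξ^{−1}`; the cosets `N·n`,
  `n ≠ 0`, lie at distance `≥ N ≥ ξ^{−1}` and contribute `≤ 140·Π_μe^{−(|n_μ|−1)⁺/6}`, summed by p03's `sum_prod_le` to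
  `≤ 140·(1 + 2/(1 − e^{−1/6}))³ ≤ 140·3375`); hence `0 ≤ C^ξ_T(y,y′) ≤ (torusConst + 472501)ξ^{−1}` for ALL `y, y′` (`CxiT_le_all`,
  off the diagonal p03's `abs_CxiT_le`).
* §4 **`abs_first324_CxiT_le`** (d = 3, `0 < ξ ≤ 1`, `ξN ≥ 1`): `|Σ_{y′}ξ³(∂^ξ_μC^ξ_T)(y,y′)C^ξ_T(y,y′)| ≤ κ_T :=
  ((torusConst + 472501)² + 108·3037500²)/2` for every `y`, `μ` — UNIFORMLY in `ξ` and in the volume: by §1 the sum is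
  `(ξ⁴/2)Σ_{y′}((∂^ξ_μC^ξ_T)(y,y′))²`; the diagonal term is `≤ (torusConst + 472501)²ξ^{−4}` (§3), the others
  `≤ 3037500²(ξ|y−y′|_∞)^{−4}` by this seat's derivative bound `B3CxiTorusDerivativeBound.abs_d1Kernel_CxiT_le'`, summed by §2.
  This is the torus counterpart of the printed *"has a finite limit as ξ → 0"* in its BOUNDEDNESS form (no divergence as `ξ → 0`;
  the limit itself is p03's `eq324_rhs_finite_limit` on `ξℤ³` and is not re-proved here).
* §5 **`abs_bracket323_CxiT_le`** — *"Hence the last graph in (3.22) defines a vertex with some convergent function"* for the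
  `C^ξ_T·C^ξ_T` member: with `G^ξ_{j″}(0) = G^ξ_{j″} = C^ξ_T`, `|g|, |g′| ≤ 1` and `g′` Lipschitz (`|g′(y′) − g′(y)| ≤ Kξ|y − y′|₁`), r15's
  whole bracket satisfies `|[(3.23)](y)| ≤ κ_T + 3·3037500·torusConst·K·radialConst 3 ½ 1 0` for every `y`, all `0 < ξ ≤ 1` and every
  volume with `ξN ≥ 1` (first term: §4; second term: `B3Bound323.abs_bracket323_CxiT_sub_first_le`).
HONEST SCOPE: the torus free propagator `C^ξ_T` only (the print's `G^ξ_{j″}(0)`, `G^ξ_{j″}` in an external field and the *"some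
convergent expressions"* of the replacement are not treated); `d = 3` in §§3–5 (§§1–2 any `d`); boundedness, not convergence, in §4;
constants explicit but not optimised.  Mathlib + the cited tree files only; theorems only, no new definitions, no named facts; standard
axioms.  Unit `lit-balaban-p39-g5` (Phase-2 proof seat p39, gen 5), HOME `run/shared/lean/pub/lit-balaban/`, 2026-08-21.
-/

open scoped BigOperators

namespace Literature.MathematicalPhysics.QuantumFieldTheory.Balaban1983to89.B3Eq324Torus

open LatticeFieldCalculus B3Sect3ScalarSelfEnergy B3Sect3VectorSelfEnergy B3TorusRadialSums B3Bound316 B3CxiPropagator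
  B3CxiComparisonBound B3CxiUniformBound B3CxiTorusBound B3CxiTorusDerivativeBound B3CxiTadpole B3Bound323

noncomputable section

/-! ## 1. (3.24) in position space: summation by parts for translation-invariant kernels -/

section SBP

variable {P : Params} {j : ℕ}

/-- kernel: `(y − e_μ) + e_μ = y` on the torus. [folklore] -/
private theorem shift_unshift' (y : Site P j) (μ : Fin P.d) : (y.unshift μ).shift μ = y :=
  (shiftEquiv (P := P) (j := j) μ).apply_symm_apply y

/-- kernel: if `Σa² = Σb²` then `Σ(a − b)b = −½Σ(a − b)²`. [folklore] -/
private theorem sum_sub_mul_eq_neg_half {ι : Type*} (s : Finset ι) (a b : ι → ℝ)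
    (h : ∑ i ∈ s, a i ^ 2 = ∑ i ∈ s, b i ^ 2) :
    ∑ i ∈ s, (a i - b i) * b i = -(1 / 2) * ∑ i ∈ s, (a i - b i) ^ 2 := by
  have h1 : ∑ i ∈ s, (a i - b i) ^ 2 = ∑ i ∈ s, a i ^ 2 - 2 * ∑ i ∈ s, (a i - b i) * b i - ∑ i ∈ s, b i ^ 2 := by
    rw [Finset.mul_sum, ← Finset.sum_sub_distrib, ← Finset.sum_sub_distrib]
    exact Finset.sum_congr rfl fun i _ => by ring
  rw [h1, h]
  ring

/-- kernel: translation invariance moves the shift to the second variable: `K(y + e_μ, y′) = K(y, y′ − e_μ)`. [folklore] -/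
private theorem shift_left_eq (μ : Fin P.d) (K : Kernel P j) (hK : ∀ y y' : Site P j, K (y.shift μ) (y'.shift μ) = K y y')
    (y y' : Site P j) : K (y.shift μ) y' = K y (y'.unshift μ) := by
  conv_lhs => rw [← shift_unshift' y' μ]
  exact hK y (y'.unshift μ)

/-- **(3.24) p. 439 [PDF 29] IN POSITION SPACE ON THE TORUS** — PROVED for every kernel `K` invariant under the simultaneous translation
`(y, y′) ↦ (y + e_μ, y′ + e_μ)` (every `K(y − y′)`): `Σ_{y′}ξ^d(∂^ξ_μK)(y,y′)K(y,y′) = −(ξ^{d+1}/2)Σ_{y′}((∂^ξ_μK)(y,y′))²` — the x-space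
content of the printed symmetrisation `ξ^{−1}(cos(ξp_μ) − 1) = −(ξ/2)|ξ^{−1}(e^{iξp_μ} − 1)|²` in the momentum integral of (3.24)
(`(∂^ξ_μK)(y,y′)` = r15's `d1Kernel ξ⁻¹ μ K`). [cite: Balaban1983Higgs3, (3.24) p.439] -/
theorem sum_d1Kernel_mul_self {ξ : ℝ} (hξ : ξ ≠ 0) (μ : Fin P.d) (K : Kernel P j)
    (hK : ∀ y y' : Site P j, K (y.shift μ) (y'.shift μ) = K y y') (y : Site P j) :
    ∑ y' : Site P j, ξ ^ P.d * (d1Kernel ξ⁻¹ μ K y y' * K y y') =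
      -(ξ ^ (P.d + 1) / 2) * ∑ y' : Site P j, (d1Kernel ξ⁻¹ μ K y y') ^ 2 := by
  -- `Σ_{y′} K(y + e_μ, y′)² = Σ_{y′} K(y, y′)²` by the reindexing `y′ ↦ y′ − e_μ`
  have hsq : ∑ y' : Site P j, K (y.shift μ) y' ^ 2 = ∑ y' : Site P j, K y y' ^ 2 := by
    calc ∑ y' : Site P j, K (y.shift μ) y' ^ 2 = ∑ y' : Site P j, K y (y'.unshift μ) ^ 2 :=
          Finset.sum_congr rfl fun y' _ => by rw [shift_left_eq μ K hK]
      _ = ∑ y' : Site P j, K y y' ^ 2 :=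
          Equiv.sum_comp (shiftEquiv (P := P) (j := j) μ).symm (fun y' => K y y' ^ 2)
  have hmain := sum_sub_mul_eq_neg_half Finset.univ (fun y' => K (y.shift μ) y') (fun y' => K y y') hsq
  have hL : ∑ y' : Site P j, ξ ^ P.d * (d1Kernel ξ⁻¹ μ K y y' * K y y') =
      ξ ^ P.d * ξ⁻¹ * ∑ y' : Site P j, (K (y.shift μ) y' - K y y') * K y y' := by
    rw [Finset.mul_sum]
    exact Finset.sum_congr rfl fun y' _ => by simp only [d1Kernel]; ring
  have hR : ∑ y' : Site P j, (d1Kernel ξ⁻¹ μ K y y') ^ 2 =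
      ξ⁻¹ ^ 2 * ∑ y' : Site P j, (K (y.shift μ) y' - K y y') ^ 2 := by
    rw [Finset.mul_sum]
    exact Finset.sum_congr rfl fun y' _ => by simp only [d1Kernel]; ring
  rw [hL, hR, hmain]
  have h2 : ξ ^ (P.d + 1) * ξ⁻¹ ^ 2 = ξ ^ P.d * ξ⁻¹ := by
    rw [pow_succ]
    field_simp
  calc ξ ^ P.d * ξ⁻¹ * (-(1 / 2) * ∑ i : Site P j, (K (y.shift μ) i - K y i) ^ 2)
      = -((ξ ^ P.d * ξ⁻¹) / 2) * ∑ i : Site P j, (K (y.shift μ) i - K y i) ^ 2 := by ring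
    _ = -((ξ ^ (P.d + 1) * ξ⁻¹ ^ 2) / 2) * ∑ i : Site P j, (K (y.shift μ) i - K y i) ^ 2 := by rw [h2]
    _ = _ := by ring

/-- The instance `K = C^ξ_T` (translation invariant: `CxiT_shift_shift`): the printed first-term sum of p. 439 on the torus,
`Σ_{y′}ξ^d(∂^ξ_μC^ξ_T)(y,y′)C^ξ_T(y,y′) = −(ξ^{d+1}/2)Σ_{y′}((∂^ξ_μC^ξ_T)(y,y′))²` — in particular it is `≤ 0`.
[cite: Balaban1983Higgs3, (3.24) p.439] -/
theorem first324_CxiT_eq {ξ : ℝ} (hξ : ξ ≠ 0) (μ : Fin P.d) (y : Site P j) :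
    ∑ y' : Site P j, ξ ^ P.d * (d1Kernel ξ⁻¹ μ (CxiT ξ) y y' * CxiT ξ y y') =
      -(ξ ^ (P.d + 1) / 2) * ∑ y' : Site P j, (d1Kernel ξ⁻¹ μ (CxiT ξ) y y') ^ 2 :=
  sum_d1Kernel_mul_self hξ μ (CxiT ξ) (fun y y' => CxiT_shift_shift ξ y y' μ) y

/-- Sign: the first-term sum is nonpositive for `ξ > 0`. [cite: Balaban1983Higgs3, (3.24) p.439] -/
theorem first324_CxiT_nonpos {ξ : ℝ} (hξ : 0 < ξ) (μ : Fin P.d) (y : Site P j) :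
    ∑ y' : Site P j, ξ ^ P.d * (d1Kernel ξ⁻¹ μ (CxiT ξ) y y' * CxiT ξ y y') ≤ 0 := by
  rw [first324_CxiT_eq hξ.ne' μ y]
  have h1 : 0 ≤ ∑ y' : Site P j, (d1Kernel ξ⁻¹ μ (CxiT ξ) y y') ^ 2 := Finset.sum_nonneg fun _ _ => sq_nonneg _
  have h2 : 0 ≤ ξ ^ (P.d + 1) / 2 := by positivity
  nlinarith

end SBP

/-! ## 2. The lattice sum Σ_{y′ ≠ y} |y − y′|_∞^{−(d+1)} is bounded on every torus -/

section LatticeSum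

variable {P : Params} {j : ℕ}

/-- **`Σ_{y′ ≠ y}|y − y′|_∞^{−(d+1)} ≤ 4d·3^{d−1}`** on every torus `T^{(j)}` (`d ≥ 1`): the sup-norm shells have
`#{|y − y′|_∞ = s} ≤ 2d(2s+1)^{d−1} ≤ 2d·3^{d−1}s^{d−1}` (`card_shell_le`) and `Σ_{s≥1}s^{−2} ≤ 2`. [cite: Balaban1983Higgs3, (3.24) p.439] -/
theorem sum_ne_inv_pow_succ_le (hd : 1 ≤ P.d) (y : Site P j) :
    ∑ y' ∈ Finset.univ.filter (fun y' : Site P j => y' ≠ y), (((supDist y y' : ℕ) : ℝ) ^ (P.d + 1))⁻¹ ≤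
      4 * P.d * 3 ^ (P.d - 1) := by
  classical
  set S : Finset (Site P j) := Finset.univ.filter (fun y' : Site P j => y' ≠ y) with hS
  set f : ℕ → ℝ := fun s => (((s : ℕ) : ℝ) ^ (P.d + 1))⁻¹ with hf
  have hf0 : ∀ s, 0 ≤ f s := fun s => by positivity
  -- fibre decomposition along `s = |y − y′|_∞`
  have hcomp : ∑ y' ∈ S, f (supDist y y') = ∑ s ∈ S.image (supDist y), ((S.filter fun y' => supDist y y' = s).card : ℝ) * f s := by
    rw [Finset.sum_comp]
    exact Finset.sum_congr rfl fun s _ => by rw [nsmul_eq_mul]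
  -- every radius in the image is `≥ 1`
  have hs1 : ∀ s ∈ S.image (supDist y), 1 ≤ s := by
    intro s hs
    obtain ⟨y', hy', rfl⟩ := Finset.mem_image.mp hs
    have hne : y' ≠ y := (Finset.mem_filter.mp hy').2
    by_contra h0
    exact hne (((supDist_eq_zero_iff y y').mp (by omega)).symm)
  -- the fibre is contained in the shell, whose cardinality is `≤ 2d(2s+1)^{d−1} ≤ 2d·3^{d−1}·s^{d−1}`
  have hcard : ∀ s ∈ S.image (supDist y),
      ((S.filter fun y' => supDist y y' = s).card : ℝ) ≤ 2 * P.d * 3 ^ (P.d - 1) * (s : ℝ) ^ (P.d - 1) := by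
    intro s hs
    have h1 := hs1 s hs
    have hsub : (S.filter fun y' => supDist y y' = s) ⊆ shell y s := by
      intro y' hy'
      exact Finset.mem_filter.mpr ⟨Finset.mem_univ _, (Finset.mem_filter.mp hy').2⟩
    have hc : ((S.filter fun y' => supDist y y' = s).card : ℝ) ≤ (shell y s).card := by
      exact_mod_cast Finset.card_le_card hsub
    refine hc.trans ((card_shell_le y h1).trans ?_)
    have h3 : (2 * (s : ℝ) + 1) ^ (P.d - 1) ≤ (3 * (s : ℝ)) ^ (P.d - 1) := by
      apply pow_le_pow_left₀ (by positivity)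
      have : (1 : ℝ) ≤ s := by exact_mod_cast h1
      linarith
    calc 2 * (P.d : ℝ) * (2 * (s : ℝ) + 1) ^ (P.d - 1) ≤ 2 * P.d * (3 * (s : ℝ)) ^ (P.d - 1) :=
          mul_le_mul_of_nonneg_left h3 (by positivity)
      _ = 2 * P.d * 3 ^ (P.d - 1) * (s : ℝ) ^ (P.d - 1) := by rw [mul_pow]; ring
  -- per radius: `#fibre · s^{−(d+1)} ≤ 2d·3^{d−1}·s^{−2}`
  have hterm : ∀ s ∈ S.image (supDist y),
      ((S.filter fun y' => supDist y y' = s).card : ℝ) * f s ≤ 2 * P.d * 3 ^ (P.d - 1) * (((s : ℕ) : ℝ) ^ 2)⁻¹ := by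
    intro s hs
    have h1 := hs1 s hs
    have hs0 : (0 : ℝ) < s := by exact_mod_cast h1
    calc ((S.filter fun y' => supDist y y' = s).card : ℝ) * f s
        ≤ 2 * P.d * 3 ^ (P.d - 1) * (s : ℝ) ^ (P.d - 1) * f s := mul_le_mul_of_nonneg_right (hcard s hs) (hf0 s)
      _ = 2 * P.d * 3 ^ (P.d - 1) * (((s : ℕ) : ℝ) ^ 2)⁻¹ := by
          simp only [hf]
          have hsplit : (s : ℝ) ^ (P.d + 1) = (s : ℝ) ^ (P.d - 1) * (s : ℝ) ^ 2 := by
            rw [← pow_add]; congr 1; omega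
          rw [hsplit]
          field_simp
  -- the radii lie in `(0, M)` with `M` past the largest one, and `Σ_{0<s<M} s^{−2} ≤ 2`
  set M : ℕ := (S.image (supDist y)).sup id + 1 with hM
  have hsubI : S.image (supDist y) ⊆ Finset.Ioo 0 M := by
    intro s hs
    rw [Finset.mem_Ioo]
    refine ⟨hs1 s hs, ?_⟩
    have : s ≤ (S.image (supDist y)).sup id := Finset.le_sup (f := id) hs
    omega
  have hI : ∑ s ∈ S.image (supDist y), (((s : ℕ) : ℝ) ^ 2)⁻¹ ≤ 2 := by
    calc ∑ s ∈ S.image (supDist y), (((s : ℕ) : ℝ) ^ 2)⁻¹ ≤ ∑ s ∈ Finset.Ioo 0 M, (((s : ℕ) : ℝ) ^ 2)⁻¹ :=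
          Finset.sum_le_sum_of_subset_of_nonneg hsubI fun s _ _ => by positivity
      _ ≤ 2 / ((0 : ℕ) + 1 : ℝ) := by exact_mod_cast sum_Ioo_inv_sq_le (α := ℝ) 0 M
      _ = 2 := by norm_num
  calc ∑ y' ∈ S, (((supDist y y' : ℕ) : ℝ) ^ (P.d + 1))⁻¹ = ∑ y' ∈ S, f (supDist y y') := rfl
    _ = ∑ s ∈ S.image (supDist y), ((S.filter fun y' => supDist y y' = s).card : ℝ) * f s := hcomp
    _ ≤ ∑ s ∈ S.image (supDist y), 2 * P.d * 3 ^ (P.d - 1) * (((s : ℕ) : ℝ) ^ 2)⁻¹ := Finset.sum_le_sum hterm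
    _ = 2 * P.d * 3 ^ (P.d - 1) * ∑ s ∈ S.image (supDist y), (((s : ℕ) : ℝ) ^ 2)⁻¹ := by rw [Finset.mul_sum]
    _ ≤ 2 * P.d * 3 ^ (P.d - 1) * 2 := mul_le_mul_of_nonneg_left hI (by positivity)
    _ = 4 * P.d * 3 ^ (P.d - 1) := by ring

end LatticeSum

/-! ## 3. The diagonal of the torus propagator (d = 3): C^ξ_T(y,y) ≤ 472501·ξ^{−1} -/

section Diagonal

/-- kernel: `(1 + 2/(1 − e^{−1/6}))³ ≤ 3375` (`e^{−1/6} ≤ 6/7`). [folklore] -/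
private theorem geomConst_le : (1 + 2 / (1 - Real.exp (-(1 / 6)))) ^ 3 ≤ 3375 := by
  have h1 : Real.exp (-(1 / 6)) ≤ 6 / 7 := by
    have h := Real.add_one_le_exp (1 / 6 : ℝ)
    rw [Real.exp_neg, inv_le_comm₀ (Real.exp_pos _) (by norm_num)]
    linarith
  have h2 : 0 < 1 - Real.exp (-(1 / 6)) := by linarith
  have h3 : 2 / (1 - Real.exp (-(1 / 6))) ≤ 14 := by
    rw [div_le_iff₀ h2]; linarith
  have h4 : 0 ≤ 1 + 2 / (1 - Real.exp (-(1 / 6))) := by positivity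
  calc (1 + 2 / (1 - Real.exp (-(1 / 6)))) ^ 3 ≤ (15 : ℝ) ^ 3 := pow_le_pow_left₀ h4 (by linarith) 3
    _ = 3375 := by norm_num

/-- kernel: the tadpole constant `3(π+1)/(4π) ≤ 1` (`π ≥ 3`). [folklore] -/
private theorem tadpoleConst_le_one : 3 * (Real.pi + 1) / (4 * Real.pi) ≤ 1 := by
  have hπ := Real.pi_gt_three
  rw [div_le_one (by positivity)]
  linarith

/-- kernel: the coset term of the diagonal for `n ≠ 0` (d = 3, `0 < ξ ≤ 1`, `ξN ≥ 1`): `C^ξ(N·n) ≤ 140·Π_μ q^{(|n_μ|−1)⁺}`, `q = e^{−1/6}`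
(the point lies at physical distance `ξN|n|_∞ ≥ 1`). [cite: Balaban1983Higgs3, (3.16) p.437] -/
private theorem Cxi_cosetPt_zero_le {ξ : ℝ} (hξ : 0 < ξ) (hξ1 : ξ ≤ 1) {N : ℕ} (hN : 1 ≤ ξ * N) {n : ZSite 3} (hn : n ≠ 0) :
    Cxi 3 ξ (cosetPt N 0 n) ≤ 140 * ∏ μ : Fin 3, Real.exp (-(1 / 6)) ^ ((n μ).natAbs - 1) := by
  -- a direction in which `n` is nonzero
  have hex : ∃ μ : Fin 3, n μ ≠ 0 := by
    by_contra h
    push Not at h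
    exact hn (funext h)
  obtain ⟨ν, hν⟩ := hex
  have hN1 : (1 : ℝ) ≤ N := hN.trans (mul_le_of_le_one_left (Nat.cast_nonneg N) hξ1)
  have hNne : N ≠ 0 := by
    rintro rfl
    norm_num at hN1
  set x := cosetPt N 0 n with hx
  have hxν : x ν = N * n ν := by rw [hx, cosetPt_apply, Pi.zero_apply, zero_add]
  have hx0 : x ≠ 0 := by
    intro h0
    have h00 : x ν = 0 := by rw [h0]; rfl
    rw [hxν] at h00
    rcases mul_eq_zero.mp h00 with h | h
    · exact hNne (by exact_mod_cast h)
    · exact hν h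
  -- `|x|_∞ ≥ N`
  have hNx : (N : ℝ) ≤ supn x := by
    have h2 : ((x ν).natAbs : ℝ) ≤ supn x := by rw [← supZ_three]; exact natAbs_le_supZ x ν
    have h3 : (x ν).natAbs = N * (n ν).natAbs := by rw [hxν, Int.natAbs_mul, Int.natAbs_natCast]
    have h4 : (1 : ℝ) ≤ (n ν).natAbs := by exact_mod_cast Int.natAbs_pos.2 hν
    have h5 : (N : ℝ) ≤ ((x ν).natAbs : ℝ) := by
      rw [h3, Nat.cast_mul]
      nlinarith [Nat.cast_nonneg (α := ℝ) N]
    exact h5.trans h2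
  have h1 := Cxi_three_le_sup hξ hξ1 x hx0
  rw [← supn_eq_supNorm] at h1
  -- the two factors: `e^{−ξ|x|/2} ≤ Π_μ q^{(|n_μ|−1)⁺}` and `(ξ|x|)^{−1} ≤ 1`
  have hzN : ∀ μ : Fin 3, 2 * ((0 : ZSite 3) μ).natAbs ≤ N := fun μ => by simp
  have hE := exp_cosetPt_le hξ.le hzN n
  rw [← hx] at hE
  have h1fac : Real.exp (-(1 / 2 * (ξ * supn (0 : ZSite 3)))) ≤ 1 := by
    have hs0 : (0 : ℝ) ≤ supn (0 : ZSite 3) := by unfold supn; exact Nat.cast_nonneg _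
    exact Real.exp_le_one_iff.mpr (by nlinarith [hξ.le])
  have hq : Real.exp (-(ξ * N / 6)) ≤ Real.exp (-(1 / 6)) := Real.exp_le_exp.2 (by linarith)
  have hq0 : 0 ≤ Real.exp (-(ξ * N / 6)) := (Real.exp_pos _).le
  have hprod : ∏ μ : Fin 3, Real.exp (-(ξ * N / 6)) ^ ((n μ).natAbs - 1) ≤
      ∏ μ : Fin 3, Real.exp (-(1 / 6)) ^ ((n μ).natAbs - 1) :=
    Finset.prod_le_prod (fun μ _ => pow_nonneg hq0 _) fun μ _ => pow_le_pow_left₀ hq0 hq _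
  have hP1 : 0 ≤ ∏ μ : Fin 3, Real.exp (-(ξ * N / 6)) ^ ((n μ).natAbs - 1) :=
    Finset.prod_nonneg fun μ _ => pow_nonneg hq0 _
  have hexp : Real.exp (-(ξ * supn x / 2)) ≤ ∏ μ : Fin 3, Real.exp (-(1 / 6)) ^ ((n μ).natAbs - 1) := by
    have hre : Real.exp (-(ξ * supn x / 2)) = Real.exp (-(1 / 2 * (ξ * supn x))) := by
      congr 1; ring
    rw [hre]
    calc Real.exp (-(1 / 2 * (ξ * supn x)))
        ≤ Real.exp (-(1 / 2 * (ξ * supn (0 : ZSite 3)))) * ∏ μ : Fin 3, Real.exp (-(ξ * N / 6)) ^ ((n μ).natAbs - 1) := hE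
      _ ≤ 1 * ∏ μ : Fin 3, Real.exp (-(1 / 6)) ^ ((n μ).natAbs - 1) := mul_le_mul h1fac hprod hP1 zero_le_one
      _ = _ := one_mul _
  have hden : 1 ≤ ξ * supn x := hN.trans (mul_le_mul_of_nonneg_left hNx hξ.le)
  calc Cxi 3 ξ x ≤ 140 * Real.exp (-(ξ * supn x / 2)) / (ξ * supn x) := h1
    _ ≤ 140 * Real.exp (-(ξ * supn x / 2)) / 1 :=
        div_le_div_of_nonneg_left (by positivity) one_pos hden
    _ ≤ 140 * ∏ μ : Fin 3, Real.exp (-(1 / 6)) ^ ((n μ).natAbs - 1) := by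
        rw [div_one]; exact mul_le_mul_of_nonneg_left hexp (by norm_num)

/-- **The diagonal of the periodized propagator** (d = 3, `0 < ξ ≤ 1`, `ξN ≥ 1`): `Σ'_n C^ξ(N·n) ≤ 472501·ξ^{−1}` — the `n = 0` term is
the tadpole `C^ξ(0) ≤ ξ^{−1}` (r15's `Cxi_zero_le_three`), the cosets `n ≠ 0` contribute `≤ 140·(1 + 2/(1 − e^{−1/6}))³ ≤ 472500`.
[cite: Balaban1983Higgs3, (3.24) p.439] -/
theorem perCxi_zero_le {d : ℕ} (hd : d = 3) {ξ : ℝ} (hξ : 0 < ξ) (hξ1 : ξ ≤ 1) {N : ℕ} (hN : 1 ≤ ξ * N) :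
    perCxi d ξ N 0 ≤ 472501 * ξ⁻¹ := by
  subst hd
  classical
  have hξi : 1 ≤ ξ⁻¹ := one_le_inv_iff₀.mpr ⟨hξ, hξ1⟩
  have hq0 : 0 ≤ Real.exp (-(1 / 6)) := (Real.exp_pos _).le
  have hq1 : Real.exp (-(1 / 6)) < 1 := Real.exp_lt_one_iff.2 (by norm_num)
  -- the `n = 0` term: the tadpole
  have h00 : cosetPt N (0 : ZSite 3) (0 : ZSite 3) = 0 := by
    funext μ; simp [cosetPt_apply]
  have hC0 : Cxi 3 ξ 0 ≤ ξ⁻¹ :=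
    (Cxi_zero_le_three hξ).trans (mul_le_of_le_one_left (inv_nonneg.mpr hξ.le) tadpoleConst_le_one)
  have hF : ∀ F : Finset (ZSite 3), ∑ n ∈ F, Cxi 3 ξ (cosetPt N 0 n) ≤ ξ⁻¹ + 140 * 3375 := by
    intro F
    rw [← Finset.sum_filter_add_sum_filter_not F (fun n : ZSite 3 => n = 0)]
    have h1 : ∑ n ∈ F.filter (fun n : ZSite 3 => n = 0), Cxi 3 ξ (cosetPt N 0 n) ≤ ξ⁻¹ := by
      calc ∑ n ∈ F.filter (fun n : ZSite 3 => n = 0), Cxi 3 ξ (cosetPt N 0 n)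
          ≤ ∑ n ∈ ({0} : Finset (ZSite 3)), Cxi 3 ξ (cosetPt N 0 n) :=
            Finset.sum_le_sum_of_subset_of_nonneg
              (fun n hn => Finset.mem_singleton.mpr (Finset.mem_filter.mp hn).2) (fun n _ _ => Cxi_nonneg hξ _)
        _ = Cxi 3 ξ 0 := by rw [Finset.sum_singleton, h00]
        _ ≤ ξ⁻¹ := hC0
    have h2 : ∑ n ∈ F.filter (fun n : ZSite 3 => ¬n = 0), Cxi 3 ξ (cosetPt N 0 n) ≤ 140 * 3375 := by
      calc ∑ n ∈ F.filter (fun n : ZSite 3 => ¬n = 0), Cxi 3 ξ (cosetPt N 0 n)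
          ≤ ∑ n ∈ F.filter (fun n : ZSite 3 => ¬n = 0), 140 * ∏ μ : Fin 3, Real.exp (-(1 / 6)) ^ ((n μ).natAbs - 1) :=
            Finset.sum_le_sum fun n hn => Cxi_cosetPt_zero_le hξ hξ1 hN (Finset.mem_filter.mp hn).2
        _ = 140 * ∑ n ∈ F.filter (fun n : ZSite 3 => ¬n = 0), ∏ μ : Fin 3, Real.exp (-(1 / 6)) ^ ((n μ).natAbs - 1) := by
            rw [Finset.mul_sum]
        _ ≤ 140 * 3375 := mul_le_mul_of_nonneg_left ((sum_prod_le hq0 hq1 _).trans geomConst_le) (by norm_num)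
    linarith
  have hb : 0 ≤ ξ⁻¹ + 140 * 3375 := by positivity
  calc perCxi 3 ξ N 0 = ∑' n : ZSite 3, Cxi 3 ξ (cosetPt N 0 n) := rfl
    _ ≤ ξ⁻¹ + 140 * 3375 := tsum_le_of_sum_le' hb hF
    _ ≤ 472501 * ξ⁻¹ := by nlinarith

variable {P : Params} {j : ℕ}

/-- **`C^ξ_T(y,y) ≤ 472501·ξ^{−1}`** (d = 3, `0 < ξ ≤ 1`, side `ξN ≥ 1`): the diagonal of the torus free propagator is of the
tadpole size `O(ξ^{−1})`, uniformly in the volume. [cite: Balaban1983Higgs3, (3.24) p.439] -/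
theorem CxiT_diag_le (hd : P.d = 3) {ξ : ℝ} (hξ : 0 < ξ) (hξ1 : ξ ≤ 1) (hN : 1 ≤ ξ * (P.sitesPerDir j : ℝ)) (y : Site P j) :
    CxiT ξ y y ≤ 472501 * ξ⁻¹ := by
  have h0 : liftZ y y = 0 := (liftZ_eq_zero_iff y y).2 rfl
  show perCxi P.d ξ (P.sitesPerDir j) (liftZ y y) ≤ _
  rw [h0]
  exact perCxi_zero_le hd hξ hξ1 hN

/-- **`0 ≤ C^ξ_T(y,y′) ≤ (torusConst + 472501)·ξ^{−1}` for ALL `y, y′`** (d = 3, `0 < ξ ≤ 1`, `ξN ≥ 1`): off the diagonal by p03's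
`abs_CxiT_le` (`torusConst·e^{−ξs/2}/(ξs) ≤ torusConst/ξ`, `s ≥ 1`), on it by `CxiT_diag_le`. [cite: Balaban1983Higgs3, (3.24) p.439] -/
theorem CxiT_le_all (hd : P.d = 3) {ξ : ℝ} (hξ : 0 < ξ) (hξ1 : ξ ≤ 1) (hN : 1 ≤ ξ * (P.sitesPerDir j : ℝ)) (y y' : Site P j) :
    CxiT ξ y y' ≤ (torusConst + 472501) * ξ⁻¹ := by
  have hT := torusConst_nonneg
  have hξi : 0 < ξ⁻¹ := inv_pos.mpr hξ
  by_cases hne : y' = y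
  · subst hne
    have h := CxiT_diag_le hd hξ hξ1 hN y'
    nlinarith
  · have h := abs_CxiT_le hd hξ hξ1 hN hne
    rw [abs_of_nonneg (CxiT_nonneg hξ y y')] at h
    have hs1 : (1 : ℝ) ≤ (supDist y y' : ℝ) := by
      have h0 : supDist y y' ≠ 0 := fun h0 => hne (((supDist_eq_zero_iff y y').mp h0).symm)
      exact_mod_cast Nat.one_le_iff_ne_zero.mpr h0
    have he : Real.exp (-(1 / 2 * (ξ * (supDist y y' : ℝ)))) ≤ 1 :=
      Real.exp_le_one_iff.mpr (by nlinarith [hξ.le])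
    have hinv : (ξ * (supDist y y' : ℝ))⁻¹ ≤ ξ⁻¹ := by
      rw [mul_inv]
      calc ξ⁻¹ * ((supDist y y' : ℝ))⁻¹ ≤ ξ⁻¹ * 1 :=
            mul_le_mul_of_nonneg_left (inv_le_one_of_one_le₀ hs1) hξi.le
        _ = ξ⁻¹ := mul_one _
    calc CxiT ξ y y' ≤ torusConst * (ξ * (supDist y y' : ℝ))⁻¹ * Real.exp (-(1 / 2 * (ξ * (supDist y y' : ℝ)))) := h
      _ ≤ torusConst * ξ⁻¹ * 1 := by gcongr
      _ ≤ (torusConst + 472501) * ξ⁻¹ := by nlinarith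

/-- The derivative kernel ON the diagonal: `|(∂^ξ_μC^ξ_T)(y,y)| ≤ (torusConst + 472501)·ξ^{−2}` (both values of `C^ξ_T` entering the
difference quotient lie in `[0, (torusConst + 472501)ξ^{−1}]`). [cite: Balaban1983Higgs3, (3.24) p.439] -/
theorem abs_d1Kernel_CxiT_diag_le (hd : P.d = 3) {ξ : ℝ} (hξ : 0 < ξ) (hξ1 : ξ ≤ 1) (hN : 1 ≤ ξ * (P.sitesPerDir j : ℝ))
    (μ : Fin P.d) (y : Site P j) :
    |d1Kernel ξ⁻¹ μ (CxiT ξ) y y| ≤ (torusConst + 472501) * (ξ ^ 2)⁻¹ := by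
  have ha := CxiT_le_all hd hξ hξ1 hN (y.shift μ) y
  have hb := CxiT_le_all hd hξ hξ1 hN y y
  have ha0 := CxiT_nonneg hξ (y.shift μ) y
  have hb0 := CxiT_nonneg hξ y y
  have hdiff : |CxiT ξ (y.shift μ) y - CxiT ξ y y| ≤ (torusConst + 472501) * ξ⁻¹ := by
    rw [abs_sub_le_iff]; constructor <;> linarith
  unfold d1Kernel
  rw [abs_mul, abs_of_pos (inv_pos.mpr hξ)]
  calc ξ⁻¹ * |CxiT ξ (y.shift μ) y - CxiT ξ y y| ≤ ξ⁻¹ * ((torusConst + 472501) * ξ⁻¹) :=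
        mul_le_mul_of_nonneg_left hdiff (inv_pos.mpr hξ).le
    _ = (torusConst + 472501) * (ξ ^ 2)⁻¹ := by rw [pow_two, mul_inv]; ring

end Diagonal

/-! ## 4. The first-term sum of p. 439 is bounded uniformly in ξ and in the volume (d = 3) -/

section FirstTerm

variable {P : Params} {j : ℕ}

/-- **p. 439 [PDF 29], the first term / (3.24) ON THE TORUS — BOUNDED UNIFORMLY**: for `d = 3`, `0 < ξ ≤ 1`, side `ξN ≥ 1`, every `y`
and `μ`, `|Σ_{y′}ξ³(∂^ξ_μC^ξ_T)(y,y′)C^ξ_T(y,y′)| ≤ ((torusConst + 472501)² + 108·3037500²)/2` — a constant independent of `ξ`, `y`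
and the volume (the torus counterpart, in boundedness form, of the printed *"the expression on the right side [of (3.24)] has a
finite limit as ξ → 0"*).  By §1 the sum equals `−(ξ⁴/2)Σ_{y′}((∂^ξ_μC^ξ_T)(y,y′))²`; the diagonal square is
`≤ (torusConst + 472501)²ξ^{−4}`, the others `≤ 3037500²(ξ|y − y′|_∞)^{−4}` (`abs_d1Kernel_CxiT_le'`), summed by
`Σ_{y′≠y}|y−y′|_∞^{−4} ≤ 108`. [cite: Balaban1983Higgs3, (3.24) p.439] -/
theorem abs_first324_CxiT_le (hd : P.d = 3) {ξ : ℝ} (hξ : 0 < ξ) (hξ1 : ξ ≤ 1) (hN : 1 ≤ ξ * (P.sitesPerDir j : ℝ))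
    (μ : Fin P.d) (y : Site P j) :
    |∑ y' : Site P j, ξ ^ P.d * (d1Kernel ξ⁻¹ μ (CxiT ξ) y y' * CxiT ξ y y')| ≤
      ((torusConst + 472501) ^ 2 + 108 * 3037500 ^ 2) / 2 := by
  classical
  set D : ℝ := torusConst + 472501 with hD
  have hD0 : 0 ≤ D := by have := torusConst_nonneg; rw [hD]; linarith
  set F : Site P j → ℝ := fun y' => (d1Kernel ξ⁻¹ μ (CxiT ξ) y y') ^ 2 with hF
  -- §1: the sum is −(ξ⁴/2)·Σ F
  rw [first324_CxiT_eq hξ.ne' μ y, hd]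
  have hS0 : 0 ≤ ∑ y' : Site P j, F y' := Finset.sum_nonneg fun _ _ => sq_nonneg _
  rw [abs_mul, abs_neg, abs_of_nonneg (by positivity : (0 : ℝ) ≤ ξ ^ (3 + 1) / 2),
    abs_of_nonneg hS0]
  -- split off the diagonal
  have hsplit : ∑ y' : Site P j, F y' = F y + ∑ y' ∈ Finset.univ.filter (fun y' : Site P j => y' ≠ y), F y' := by
    rw [← Finset.sum_filter_add_sum_filter_not Finset.univ (fun y' : Site P j => y' = y)]
    congr 1
    rw [Finset.filter_eq' Finset.univ y, if_pos (Finset.mem_univ y), Finset.sum_singleton]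
  -- the diagonal square
  have hdiag : F y ≤ D ^ 2 * (ξ ^ 4)⁻¹ := by
    have h := abs_d1Kernel_CxiT_diag_le hd hξ hξ1 hN μ y
    have h0 : 0 ≤ D * (ξ ^ 2)⁻¹ := by positivity
    calc F y = |d1Kernel ξ⁻¹ μ (CxiT ξ) y y| ^ 2 := (sq_abs _).symm
      _ ≤ (D * (ξ ^ 2)⁻¹) ^ 2 := pow_le_pow_left₀ (abs_nonneg _) h 2
      _ = D ^ 2 * (ξ ^ 4)⁻¹ := by rw [mul_pow, inv_pow, ← pow_mul]
  -- the off-diagonal squares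
  have hoff : ∀ y' ∈ Finset.univ.filter (fun y' : Site P j => y' ≠ y),
      F y' ≤ 3037500 ^ 2 * (ξ ^ 4)⁻¹ * ((((supDist y y' : ℕ) : ℝ)) ^ (P.d + 1))⁻¹ := by
    intro y' hy'
    have hne : y' ≠ y := (Finset.mem_filter.mp hy').2
    have h := abs_d1Kernel_CxiT_le' hd hξ hξ1 hN hne μ
    have hs0 : (0 : ℝ) < (supDist y y' : ℝ) := by
      have h0 : supDist y y' ≠ 0 := fun h0 => hne (((supDist_eq_zero_iff y y').mp h0).symm)
      exact_mod_cast Nat.pos_of_ne_zero h0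
    have he : Real.exp (-(1 / 2 * (ξ * (supDist y y' : ℝ)))) ≤ 1 :=
      Real.exp_le_one_iff.mpr (by nlinarith [hξ.le, hs0.le])
    have h1 : |d1Kernel ξ⁻¹ μ (CxiT ξ) y y'| ≤ 3037500 * ((ξ * (supDist y y' : ℝ)) ^ 2)⁻¹ := by
      calc |d1Kernel ξ⁻¹ μ (CxiT ξ) y y'|
          ≤ 3037500 * ((ξ * (supDist y y' : ℝ)) ^ 2)⁻¹ * Real.exp (-(1 / 2 * (ξ * (supDist y y' : ℝ)))) := h
        _ ≤ 3037500 * ((ξ * (supDist y y' : ℝ)) ^ 2)⁻¹ * 1 :=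
            mul_le_mul_of_nonneg_left he (by positivity)
        _ = _ := mul_one _
    have hξ0 : ξ ≠ 0 := hξ.ne'
    have hs00 : (supDist y y' : ℝ) ≠ 0 := hs0.ne'
    calc F y' = |d1Kernel ξ⁻¹ μ (CxiT ξ) y y'| ^ 2 := (sq_abs _).symm
      _ ≤ (3037500 * ((ξ * (supDist y y' : ℝ)) ^ 2)⁻¹) ^ 2 := pow_le_pow_left₀ (abs_nonneg _) h1 2
      _ = 3037500 ^ 2 * (ξ ^ 4)⁻¹ * ((((supDist y y' : ℕ) : ℝ)) ^ (P.d + 1))⁻¹ := by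
          rw [hd]
          field_simp
  have hsum : ∑ y' ∈ Finset.univ.filter (fun y' : Site P j => y' ≠ y), F y' ≤ 3037500 ^ 2 * (ξ ^ 4)⁻¹ * 108 := by
    have h1 := sum_ne_inv_pow_succ_le (P := P) (j := j) (by omega) y
    rw [hd] at h1
    have h108 : (4 : ℝ) * ((3 : ℕ) : ℝ) * 3 ^ (3 - 1) = 108 := by norm_num
    rw [h108] at h1
    calc ∑ y' ∈ Finset.univ.filter (fun y' : Site P j => y' ≠ y), F y'
        ≤ ∑ y' ∈ Finset.univ.filter (fun y' : Site P j => y' ≠ y),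
            3037500 ^ 2 * (ξ ^ 4)⁻¹ * ((((supDist y y' : ℕ) : ℝ)) ^ (P.d + 1))⁻¹ := Finset.sum_le_sum hoff
      _ = 3037500 ^ 2 * (ξ ^ 4)⁻¹ *
            ∑ y' ∈ Finset.univ.filter (fun y' : Site P j => y' ≠ y), ((((supDist y y' : ℕ) : ℝ)) ^ (P.d + 1))⁻¹ := by
          rw [Finset.mul_sum]
      _ ≤ 3037500 ^ 2 * (ξ ^ 4)⁻¹ * 108 := by
          refine mul_le_mul_of_nonneg_left ?_ (by positivity)
          rw [hd]; exact h1
  -- assemble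
  have hξ4 : ξ ^ (3 + 1) / 2 * (ξ ^ 4)⁻¹ = 1 / 2 := by
    have : ξ ^ 4 ≠ 0 := pow_ne_zero 4 hξ.ne'
    field_simp
  calc ξ ^ (3 + 1) / 2 * ∑ y' : Site P j, F y'
      = ξ ^ (3 + 1) / 2 * (F y + ∑ y' ∈ Finset.univ.filter (fun y' : Site P j => y' ≠ y), F y') := by rw [hsplit]
    _ ≤ ξ ^ (3 + 1) / 2 * (D ^ 2 * (ξ ^ 4)⁻¹ + 3037500 ^ 2 * (ξ ^ 4)⁻¹ * 108) := by
        refine mul_le_mul_of_nonneg_left (add_le_add hdiag hsum) (by positivity)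
    _ = (ξ ^ (3 + 1) / 2 * (ξ ^ 4)⁻¹) * (D ^ 2 + 108 * 3037500 ^ 2) := by ring
    _ = (D ^ 2 + 108 * 3037500 ^ 2) / 2 := by rw [hξ4]; ring

/-- The same bound for the printed first term WITH its localization factors `g(y)g′(y)` (`|g|, |g′| ≤ 1`):
`|g(y)g′(y)Σ_{y′}ξ³(∂^ξ_μC^ξ_T)(y,y′)C^ξ_T(y,y′)| ≤ ((torusConst + 472501)² + 108·3037500²)/2`. [cite: Balaban1983Higgs3, (3.24) p.439] -/
theorem abs_first323_CxiT_le (hd : P.d = 3) {ξ : ℝ} (hξ : 0 < ξ) (hξ1 : ξ ≤ 1) (hN : 1 ≤ ξ * (P.sitesPerDir j : ℝ))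
    (g g' : SiteField P j ℝ) (hg : ∀ y, |g y| ≤ 1) (hg' : ∀ y, |g' y| ≤ 1) (μ : Fin P.d) (y : Site P j) :
    |g y * g' y * ∑ y' : Site P j, ξ ^ P.d * (d1Kernel ξ⁻¹ μ (CxiT ξ) y y' * CxiT ξ y y')| ≤
      ((torusConst + 472501) ^ 2 + 108 * 3037500 ^ 2) / 2 := by
  have h := abs_first324_CxiT_le hd hξ hξ1 hN μ y
  have h0 : 0 ≤ |∑ y' : Site P j, ξ ^ P.d * (d1Kernel ξ⁻¹ μ (CxiT ξ) y y' * CxiT ξ y y')| := abs_nonneg _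
  have hgg : |g y| * |g' y| ≤ 1 :=
    calc |g y| * |g' y| ≤ 1 * 1 := mul_le_mul (hg y) (hg' y) (abs_nonneg _) zero_le_one
      _ = 1 := mul_one 1
  rw [abs_mul, abs_mul]
  calc |g y| * |g' y| * |∑ y' : Site P j, ξ ^ P.d * (d1Kernel ξ⁻¹ μ (CxiT ξ) y y' * CxiT ξ y y')|
      ≤ 1 * |∑ y' : Site P j, ξ ^ P.d * (d1Kernel ξ⁻¹ μ (CxiT ξ) y y' * CxiT ξ y y')| :=
        mul_le_mul_of_nonneg_right hgg h0
    _ ≤ _ := by rw [one_mul]; exact h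

end FirstTerm

/-! ## 5. "Hence the last graph in (3.22) defines a vertex with some convergent function" — the C^ξ_T·C^ξ_T member -/

section Vertex

variable {P : Params} {j : ℕ}

/-- **p. 439 [PDF 29]: "Hence the last graph in (3.22) defines a vertex with some convergent function"** — PROVED for the member with
both resummed propagators the torus free propagator, `G^ξ_{j″}(0) = G^ξ_{j″} = C^ξ_T` (d = 3, `0 < ξ ≤ 1`, side `ξN ≥ 1`): with
`|g|, |g′| ≤ 1` and `g′` Lipschitz, `|g′(y′) − g′(y)| ≤ Kξ|y − y′|₁`, r15's whole vertex coefficient of (3.23) satisfies, for every `y`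
and `μ`, `|[(3.23)](y)| ≤ ((torusConst + 472501)² + 108·3037500²)/2 + 3·3037500·torusConst·K·radialConst 3 ½ 1 0` — ONE constant for
all spacings and volumes (first term: `abs_first323_CxiT_le`; second term: `B3Bound323.abs_bracket323_CxiT_sub_first_le`).
[cite: Balaban1983Higgs3, (3.23) p.439] -/
theorem abs_bracket323_CxiT_le (hd : P.d = 3) {ξ : ℝ} (hξ : 0 < ξ) (hξ1 : ξ ≤ 1) (hN : 1 ≤ ξ * (P.sitesPerDir j : ℝ))
    {K : ℝ} (hK : 0 ≤ K) (g g' : SiteField P j ℝ) (μ : Fin P.d) (hg : ∀ y, |g y| ≤ 1) (hg'1 : ∀ y, |g' y| ≤ 1)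
    (hg' : ∀ y y' : Site P j, |g' y' - g' y| ≤ K * (ξ * Site.tdist y y')) (y : Site P j) :
    |bracket323 ξ μ (CxiT ξ) (CxiT ξ) g g' y| ≤
      ((torusConst + 472501) ^ 2 + 108 * 3037500 ^ 2) / 2 +
        P.d * 3037500 * torusConst * K * radialConst P.d (1 / 2) 1 0 := by
  have h1 := abs_first323_CxiT_le hd hξ hξ1 hN g g' hg hg'1 μ y
  have h2 := abs_bracket323_CxiT_sub_first_le hd hξ hξ1 hN hK g g' μ hg hg' y
  have h3 : (P.d : ℝ) * 3037500 * torusConst * K * radialConst P.d (1 / 2) ξ 0 ≤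
      P.d * 3037500 * torusConst * K * radialConst P.d (1 / 2) 1 0 := by
    have hm := radialConst_mono P.d (by norm_num : (0 : ℝ) < 1 / 2) hξ1 0
    have hc0 : 0 ≤ (P.d : ℝ) * 3037500 * torusConst * K := by have := torusConst_nonneg; positivity
    exact mul_le_mul_of_nonneg_left hm hc0
  have htri := abs_sub_abs_le_abs_sub (bracket323 ξ μ (CxiT ξ) (CxiT ξ) g g' y)
    (g y * g' y * ∑ y' : Site P j, ξ ^ P.d * (d1Kernel ξ⁻¹ μ (CxiT ξ) y y' * CxiT ξ y y'))
  linarith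

end Vertex

end

end Literature.MathematicalPhysics.QuantumFieldTheory.Balaban1983to89.B3Eq324Torus
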